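import Summits.QuantumFields.QCD.Theorems.QuarksAsStableActionCriticalLineDiamagnetismCellFreeAmplitude
import Summits.QuantumFields.QCD.Theorems.QuarksAsStableActionCriticalLineDiamagnetismCellFreeWalks

/-!
# The cell sub-stub `cellFirstOrder` (B6 of line `Sketch`, crux stmt-QuantumFields-9734)

Crux `Summit.QuantumFields.QCD.Theses.QuarksAsStableAction.CriticalLineDiamagnetism` (item stmt-QuantumFields-9734,
sub-problem `Summits/QuantumFields/QCD/Statement.lean`), line `Sketch`, Route B step B6: the registered cell sub-stub
`cellFirstOrder` of `stub_heavyFrequencyGain` (plan `S4-PLAN.md` §B6 of the line lead).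

For the checkerboard field of one plaquette `P ∈ U(3)` on `(ℤ/2n)²` (`Cell.chk`: the first-coordinate links at odd second
coordinate carry `P`/`P⁻¹` alternately), `X = D_1⁻¹(D_P − D_1)` (`Cell.X`), the free propagator `G = D_1⁻¹`
(`Cell.D1 n = CellFO.freeOp (2n) (2n)`) and the torus link amplitude `α = Cell.alphaTor`:

* `Re Tr X = −4 n² · Re α · def(P)` EXACTLY: `D_P − D_1` is supported on the `2n²` checkerboard links; by colour triviality
  of `G` each link contributes `(amplitude) × tr(U − 1)`; by twisted translation covariance the forward amplitude is the same
  `A₀ = −α` on every link and by `γ₅`-hermiticity the backward one is `conj A₀`; the colour sums are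
  `n²(tr P − 3) + n²(conj tr P − 3)` (parity count on `ℤ/2n`).
* `|Re α − kappaOne M_ω (sin ω₀) (sin ω₁) 14| ≤ 10⁻⁶`: `α = −tr(B P₋²)` with `B` the reference link block of `G`, which is
  within `1/(4·10⁶)` of the truncated planar propagator (`cellFreePlanarBlock`, `2n ≥ 18`), and `|Re tr(E P₋²)| ≤ 4‖E‖`.
-/

noncomputable section

open scoped BigOperators Matrix ComplexConjugate Kronecker Matrix.Norms.L2Operator
open Matrix Literature.MathematicalPhysics.QuantumLattice
open Summit.QuantumFields.QCD.Cruxes.CriticalLineDiamagnetism.ChessboardCellGain.FrequencyDiamagnetism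
open Summit.QuantumFields.QCD.Cruxes.CriticalLineDiamagnetism.ChessboardCellGain.CellKappa

namespace Summit.QuantumFields.QCD.Cruxes.CriticalLineDiamagnetism.ChessboardCellGain


/-! ## The cell sub-stub `cellFirstOrder` -/

namespace CellFO
open Cell

variable {n : ℕ} [NeZero n]

/-- The heavy box: `M_ω ≥ 5.89`. -/
theorem bigM_ge {m ω₀ ω₁ : ℝ} (hm : |m| ≤ 1 / 10) (h0 : Real.cos ω₀ ≤ -(199 / 200)) (h1 : Real.cos ω₁ ≤ -(199 / 200)) :
    589 / 100 ≤ m + 4 - Real.cos ω₀ - Real.cos ω₁ := by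
  have := abs_le.mp hm
  linarith

omit [NeZero n] in
/-- `2n ≥ 17` for `n ≥ 9`. -/
theorem two_mul_ge (hn : 9 ≤ n) : 17 ≤ 2 * n := by omega

omit [NeZero n] in
/-- In `ZMod (2n)`, `0 ≠ −1`. -/
theorem zero_ne_neg_one_zmod (hn : 9 ≤ n) : (0 : ZMod (2 * n)) ≠ -1 := by
  intro h
  have h1 : (1 : ZMod (2 * n)) = 0 := by linear_combination h
  rw [ZMod.one_eq_zero_iff] at h1
  omega

/-- `Cell.D1` is the free operator `CellFO.freeOp` on the even torus. -/
theorem D1_eq_freeOp (m ω₀ ω₁ : ℝ) : D1 n m ω₀ ω₁ = freeOp (2 * n) (2 * n) m ω₀ ω₁ := rfl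

omit [NeZero n] in
/-- The checkerboard field is trivial in the second direction. -/
theorem chk_three (P : Matrix.unitaryGroup (Fin 3) ℂ) (a b : ZMod (2 * n)) : chk n P a b 3 = 1 := by
  simp [chk]

/-- **Entries of the perturbation `Δ = D_P − D_1`**: supported on the first-coordinate links. -/
theorem delta_apply (P : Matrix.unitaryGroup (Fin 3) ℂ) (m ω₀ ω₁ : ℝ) (q p : (ZMod (2 * n) × ZMod (2 * n)) × Fin 3 × Fin 4) :
    (DP n P m ω₀ ω₁ - D1 n m ω₀ ω₁) q p =
      -(1 / 2 : ℂ) * ((if p.1 = (q.1.1 + 1, q.1.2) then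
          ((1 : Matrix (Fin 4) (Fin 4) ℂ) - euclideanGamma 2) q.2.2 p.2.2 * ((if q.1.1 = -1 then (-1 : ℂ) else 1) *
            ((chk n P q.1.1 q.1.2 2 : Matrix (Fin 3) (Fin 3) ℂ) q.2.1 p.2.1 - (1 : Matrix (Fin 3) (Fin 3) ℂ) q.2.1 p.2.1))
          else 0) +
        (if q.1 = (p.1.1 + 1, p.1.2) then
          ((1 : Matrix (Fin 4) (Fin 4) ℂ) + euclideanGamma 2) q.2.2 p.2.2 * ((if p.1.1 = -1 then (-1 : ℂ) else 1) *
            ((star (chk n P p.1.1 p.1.2 2 : Matrix (Fin 3) (Fin 3) ℂ)) q.2.1 p.2.1 - (1 : Matrix (Fin 3) (Fin 3) ℂ) q.2.1 p.2.1))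
          else 0)) := by
  simp only [DP, D1, freqOpR, Matrix.sub_apply, Matrix.of_apply, chk_three, OneMemClass.coe_one, star_one]
  split_ifs <;> ring

/-! ### Sum bookkeeping -/

/-- Collapsing the trace double sum against the forward-link support. -/
theorem sum_collapse_fwd
    (Gm : Matrix ((ZMod (2 * n) × ZMod (2 * n)) × Fin 3 × Fin 4) ((ZMod (2 * n) × ZMod (2 * n)) × Fin 3 × Fin 4) ℂ)
    (Φ : ((ZMod (2 * n) × ZMod (2 * n)) × Fin 3 × Fin 4) → ((ZMod (2 * n) × ZMod (2 * n)) × Fin 3 × Fin 4) → ℂ) :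
    ∑ p, ∑ q, Gm p q * (if p.1 = (q.1.1 + 1, q.1.2) then Φ q p else 0) =
      ∑ q, ∑ c : Fin 3, ∑ i : Fin 4, Gm ((q.1.1 + 1, q.1.2), c, i) q * Φ q ((q.1.1 + 1, q.1.2), c, i) := by
  rw [Finset.sum_comm]
  refine Finset.sum_congr rfl fun q _ => ?_
  rw [Fintype.sum_prod_type, Finset.sum_comm, Fintype.sum_prod_type]
  refine Finset.sum_congr rfl fun c _ => Finset.sum_congr rfl fun i _ => ?_
  simp only [mul_ite, mul_zero, Finset.sum_ite_eq', Finset.mem_univ, if_true]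

/-- Collapsing the trace double sum against the backward-link support. -/
theorem sum_collapse_bwd
    (Gm : Matrix ((ZMod (2 * n) × ZMod (2 * n)) × Fin 3 × Fin 4) ((ZMod (2 * n) × ZMod (2 * n)) × Fin 3 × Fin 4) ℂ)
    (Ψ : ((ZMod (2 * n) × ZMod (2 * n)) × Fin 3 × Fin 4) → ((ZMod (2 * n) × ZMod (2 * n)) × Fin 3 × Fin 4) → ℂ) :
    ∑ p, ∑ q, Gm p q * (if q.1 = (p.1.1 + 1, p.1.2) then Ψ q p else 0) =
      ∑ p, ∑ c : Fin 3, ∑ j : Fin 4, Gm p ((p.1.1 + 1, p.1.2), c, j) * Ψ ((p.1.1 + 1, p.1.2), c, j) p := by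
  refine Finset.sum_congr rfl fun p _ => ?_
  rw [Fintype.sum_prod_type, Finset.sum_comm, Fintype.sum_prod_type]
  refine Finset.sum_congr rfl fun c _ => Finset.sum_congr rfl fun j _ => ?_
  simp only [mul_ite, mul_zero, Finset.sum_ite_eq', Finset.mem_univ, if_true]

omit [NeZero n] in
/-- Parity count on `ZMod (2n)` via `ℕ`: `Σ_{k<2n} [k even] u + [k odd] v = n u + n v`. -/
theorem sum_range_parity (u v : ℂ) (k : ℕ) :
    ∑ a ∈ Finset.range (2 * k), (if a % 2 = 0 then u else v) = k * u + k * v := by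
  induction k with
  | zero => simp
  | succ k ih =>
      rw [show 2 * (k + 1) = 2 * k + 1 + 1 from by ring, Finset.sum_range_succ, Finset.sum_range_succ, ih]
      have h1 : (2 * k) % 2 = 0 := by omega
      have h2 : (2 * k + 1) % 2 = 1 := by omega
      simp only [h1, h2, if_true, Nat.one_ne_zero, if_false, Nat.cast_succ]
      ring

/-- **Parity count on `ZMod (2n)`**: `Σ_a ([a even] u + [a odd] v) = n u + n v`. -/
theorem sum_parity (u v : ℂ) : ∑ a : ZMod (2 * n), (if a.val % 2 = 0 then u else v) = n * u + n * v := by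
  rw [← sum_range_parity u v n]
  refine Finset.sum_nbij (fun a : ZMod (2 * n) => a.val) (fun a _ => Finset.mem_range.mpr (ZMod.val_lt a))
    (fun a _ b _ h => ZMod.val_injective _ h) (fun k hk => ?_) (fun a _ => rfl)
  refine ⟨(k : ZMod (2 * n)), Finset.mem_coe.mpr (Finset.mem_univ _), ?_⟩
  exact ZMod.val_natCast_of_lt (Finset.mem_range.mp hk)

/-! ### The trace of `X` as a sum over links -/

/-- **`Tr X` as a sum over the forward and backward link terms.** -/
theorem trace_X_eq (P : Matrix.unitaryGroup (Fin 3) ℂ) (m ω₀ ω₁ : ℝ) :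
    (X n P m ω₀ ω₁).trace =
      -(1 / 2 : ℂ) * ((∑ q : (ZMod (2 * n) × ZMod (2 * n)) × Fin 3 × Fin 4, ∑ c : Fin 3, ∑ i : Fin 4,
          (D1 n m ω₀ ω₁)⁻¹ ((q.1.1 + 1, q.1.2), c, i) q *
            (((1 : Matrix (Fin 4) (Fin 4) ℂ) - euclideanGamma 2) q.2.2 i * ((if q.1.1 = -1 then (-1 : ℂ) else 1) *
              ((chk n P q.1.1 q.1.2 2 : Matrix (Fin 3) (Fin 3) ℂ) q.2.1 c - (1 : Matrix (Fin 3) (Fin 3) ℂ) q.2.1 c)))) +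
        (∑ p : (ZMod (2 * n) × ZMod (2 * n)) × Fin 3 × Fin 4, ∑ c : Fin 3, ∑ j : Fin 4,
          (D1 n m ω₀ ω₁)⁻¹ p ((p.1.1 + 1, p.1.2), c, j) *
            (((1 : Matrix (Fin 4) (Fin 4) ℂ) + euclideanGamma 2) j p.2.2 * ((if p.1.1 = -1 then (-1 : ℂ) else 1) *
              ((star (chk n P p.1.1 p.1.2 2 : Matrix (Fin 3) (Fin 3) ℂ)) c p.2.1 - (1 : Matrix (Fin 3) (Fin 3) ℂ) c p.2.1))))) := by
  have htr : (X n P m ω₀ ω₁).trace = ∑ p, ∑ q, (D1 n m ω₀ ω₁)⁻¹ p q * (DP n P m ω₀ ω₁ - D1 n m ω₀ ω₁) q p := by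
    simp only [Matrix.trace, Matrix.diag, X, Matrix.mul_apply]
  rw [htr]
  simp only [delta_apply]
  have hdist : ∀ (g a b : ℂ),
      g * (-(1 / 2 : ℂ) * (a + b)) = -(1 / 2 : ℂ) * (g * a) + -(1 / 2 : ℂ) * (g * b) := fun g a b => by ring
  simp only [hdist, Finset.sum_add_distrib, ← Finset.mul_sum]
  rw [sum_collapse_fwd, sum_collapse_bwd, mul_add]

omit [NeZero n] in
/-- `(1 − γ₂)_{ji} = 2 (P₋²)_{ji}`. -/
theorem oneSub_apply (j i : Fin 4) : ((1 : Matrix (Fin 4) (Fin 4) ℂ) - euclideanGamma 2) j i = 2 * pMinus 2 j i := by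
  simp only [pMinus, Matrix.smul_apply, smul_eq_mul]; ring

omit [NeZero n] in
/-- `(1 + γ₂)_{ji} = 2 (P₊²)_{ji}`. -/
theorem oneAdd_apply (j i : Fin 4) : ((1 : Matrix (Fin 4) (Fin 4) ℂ) + euclideanGamma 2) j i = 2 * pPlus 2 j i := by
  simp only [pPlus, Matrix.smul_apply, smul_eq_mul]; ring

/-- **The forward link sum**: `Σ = 2 · A₀ · S₁` with the reference amplitude `A₀` and the colour sum `S₁`. -/
theorem fwd_sum_eq (P : Matrix.unitaryGroup (Fin 3) ℂ) {m ω₀ ω₁ : ℝ} (hM : 2 < m + 4 - Real.cos ω₀ - Real.cos ω₁) :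
    (∑ q : (ZMod (2 * n) × ZMod (2 * n)) × Fin 3 × Fin 4, ∑ c : Fin 3, ∑ i : Fin 4,
          (D1 n m ω₀ ω₁)⁻¹ ((q.1.1 + 1, q.1.2), c, i) q *
            (((1 : Matrix (Fin 4) (Fin 4) ℂ) - euclideanGamma 2) q.2.2 i * ((if q.1.1 = -1 then (-1 : ℂ) else 1) *
              ((chk n P q.1.1 q.1.2 2 : Matrix (Fin 3) (Fin 3) ℂ) q.2.1 c - (1 : Matrix (Fin 3) (Fin 3) ℂ) q.2.1 c)))) =
      2 * ((if (0 : ZMod (2 * n)) = -1 then (-1 : ℂ) else 1) *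
        ∑ i : Fin 4, ∑ j : Fin 4, (D1 n m ω₀ ω₁)⁻¹ (((0 : ZMod (2 * n)) + 1, (0 : ZMod (2 * n))), 0, i)
          (((0 : ZMod (2 * n)), (0 : ZMod (2 * n))), 0, j) * pMinus 2 j i) *
      ∑ y : ZMod (2 * n) × ZMod (2 * n), ∑ c : Fin 3,
        ((chk n P y.1 y.2 2 : Matrix (Fin 3) (Fin 3) ℂ) c c - (1 : Matrix (Fin 3) (Fin 3) ℂ) c c) := by
  rw [D1_eq_freeOp, Finset.mul_sum, Fintype.sum_prod_type]
  refine Finset.sum_congr rfl fun y _ => ?_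
  rw [Finset.mul_sum, Fintype.sum_prod_type]
  refine Finset.sum_congr rfl fun c' _ => ?_
  -- collapse the colour sum
  have hcol : ∀ (j : Fin 4) (c : Fin 3) (i : Fin 4),
      (freeOp (2 * n) (2 * n) m ω₀ ω₁)⁻¹ ((y.1 + 1, y.2), c, i) (y, c', j) =
        if c = c' then (freeOp (2 * n) (2 * n) m ω₀ ω₁)⁻¹ ((y.1 + 1, y.2), 0, i) (y, 0, j) else 0 :=
    fun j c i => free_inv_colour hM _ _ c c' i j
  dsimp only
  simp only [hcol, ite_zero_mul, Finset.sum_ite_irrel, Finset.sum_const_zero, Finset.sum_ite_eq', Finset.mem_univ,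
    if_true, oneSub_apply]
  rw [← fwdAmp_const hM y, Finset.sum_comm]
  simp only [Finset.mul_sum, Finset.sum_mul]
  refine Finset.sum_congr rfl fun i _ => Finset.sum_congr rfl fun j _ => ?_
  ring

/-- **The backward link sum**: `Σ = 2 · conj A₀ · S₂`. -/
theorem bwd_sum_eq (P : Matrix.unitaryGroup (Fin 3) ℂ) {m ω₀ ω₁ : ℝ} (hM : 2 < m + 4 - Real.cos ω₀ - Real.cos ω₁) :
    (∑ p : (ZMod (2 * n) × ZMod (2 * n)) × Fin 3 × Fin 4, ∑ c : Fin 3, ∑ j : Fin 4,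
          (D1 n m ω₀ ω₁)⁻¹ p ((p.1.1 + 1, p.1.2), c, j) *
            (((1 : Matrix (Fin 4) (Fin 4) ℂ) + euclideanGamma 2) j p.2.2 * ((if p.1.1 = -1 then (-1 : ℂ) else 1) *
              ((star (chk n P p.1.1 p.1.2 2 : Matrix (Fin 3) (Fin 3) ℂ)) c p.2.1 - (1 : Matrix (Fin 3) (Fin 3) ℂ) c p.2.1)))) =
      2 * star ((if (0 : ZMod (2 * n)) = -1 then (-1 : ℂ) else 1) *
        ∑ i : Fin 4, ∑ j : Fin 4, (D1 n m ω₀ ω₁)⁻¹ (((0 : ZMod (2 * n)) + 1, (0 : ZMod (2 * n))), 0, i)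
          (((0 : ZMod (2 * n)), (0 : ZMod (2 * n))), 0, j) * pMinus 2 j i) *
      ∑ x : ZMod (2 * n) × ZMod (2 * n), ∑ c : Fin 3,
        ((star (chk n P x.1 x.2 2 : Matrix (Fin 3) (Fin 3) ℂ)) c c - (1 : Matrix (Fin 3) (Fin 3) ℂ) c c) := by
  rw [D1_eq_freeOp, Finset.mul_sum, Fintype.sum_prod_type]
  refine Finset.sum_congr rfl fun x _ => ?_
  rw [Finset.mul_sum, Fintype.sum_prod_type]
  refine Finset.sum_congr rfl fun c _ => ?_
  have hcol : ∀ (i : Fin 4) (c' : Fin 3) (j : Fin 4),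
      (freeOp (2 * n) (2 * n) m ω₀ ω₁)⁻¹ (x, c, i) ((x.1 + 1, x.2), c', j) =
        if c = c' then (freeOp (2 * n) (2 * n) m ω₀ ω₁)⁻¹ (x, 0, i) ((x.1 + 1, x.2), 0, j) else 0 :=
    fun i c' j => free_inv_colour hM _ _ c c' i j
  dsimp only
  simp only [hcol, ite_zero_mul, Finset.sum_ite_irrel, Finset.sum_const_zero, Finset.sum_ite_eq, Finset.mem_univ,
    if_true, oneAdd_apply]
  rw [← fwdAmp_const hM x, ← bwdAmp_eq_star hM x]
  simp only [Finset.mul_sum, Finset.sum_mul]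
  refine Finset.sum_congr rfl fun i _ => Finset.sum_congr rfl fun j _ => ?_
  ring

/-! ### The colour sums and the reference amplitude -/

omit [NeZero n] in
/-- The backward colour sum is the conjugate of the forward one. -/
theorem colour_sum_star (P : Matrix.unitaryGroup (Fin 3) ℂ) (s : Finset (ZMod (2 * n) × ZMod (2 * n))) :
    ∑ x ∈ s, ∑ c : Fin 3, ((star (chk n P x.1 x.2 2 : Matrix (Fin 3) (Fin 3) ℂ)) c c - (1 : Matrix (Fin 3) (Fin 3) ℂ) c c) =
      star (∑ x ∈ s, ∑ c : Fin 3, ((chk n P x.1 x.2 2 : Matrix (Fin 3) (Fin 3) ℂ) c c - (1 : Matrix (Fin 3) (Fin 3) ℂ) c c)) := by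
  simp only [star_sum, star_sub, Matrix.star_apply, Matrix.one_apply_eq, star_one]

omit [NeZero n] in
/-- The trace deficit of a checkerboard link variable. -/
theorem chk_colour_sum (P : Matrix.unitaryGroup (Fin 3) ℂ) (a b : ZMod (2 * n)) :
    ∑ c : Fin 3, ((chk n P a b 2 : Matrix (Fin 3) (Fin 3) ℂ) c c - (1 : Matrix (Fin 3) (Fin 3) ℂ) c c) =
      if b.val % 2 = 0 then 0 else
        (if a.val % 2 = 0 then (P : Matrix (Fin 3) (Fin 3) ℂ).trace - 3 else star (P : Matrix (Fin 3) (Fin 3) ℂ).trace - 3) := by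
  have h3 : ∑ c : Fin 3, (1 : Matrix (Fin 3) (Fin 3) ℂ) c c = 3 := by simp
  rw [Finset.sum_sub_distrib, h3]
  simp only [chk, true_and]
  rcases Nat.mod_two_eq_zero_or_one b.val with hb | hb
  · simp [hb]
  · simp only [hb, if_true, Nat.one_ne_zero, if_false]
    split_ifs
    · rfl
    · rw [Matrix.UnitaryGroup.inv_apply, Matrix.star_eq_conjTranspose, ← Matrix.trace_conjTranspose]
      rfl

/-- **The forward colour sum over the torus**: `S₁ = n (n (tr P − 3) + n (conj tr P − 3))`. -/
theorem colour_sum_eq (P : Matrix.unitaryGroup (Fin 3) ℂ) :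
    ∑ y : ZMod (2 * n) × ZMod (2 * n), ∑ c : Fin 3,
        ((chk n P y.1 y.2 2 : Matrix (Fin 3) (Fin 3) ℂ) c c - (1 : Matrix (Fin 3) (Fin 3) ℂ) c c) =
      (n : ℂ) * ((n : ℂ) * ((P : Matrix (Fin 3) (Fin 3) ℂ).trace - 3) +
        (n : ℂ) * (star (P : Matrix (Fin 3) (Fin 3) ℂ).trace - 3)) := by
  simp only [chk_colour_sum, Fintype.sum_prod_type]
  have inner : ∀ a : ZMod (2 * n), ∑ b : ZMod (2 * n), (if b.val % 2 = 0 then (0 : ℂ) else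
      (if a.val % 2 = 0 then (P : Matrix (Fin 3) (Fin 3) ℂ).trace - 3 else star (P : Matrix (Fin 3) (Fin 3) ℂ).trace - 3)) =
      (n : ℂ) * (if a.val % 2 = 0 then (P : Matrix (Fin 3) (Fin 3) ℂ).trace - 3
        else star (P : Matrix (Fin 3) (Fin 3) ℂ).trace - 3) := fun a => by
    rw [sum_parity]; ring
  rw [Finset.sum_congr rfl fun a _ => inner a, ← Finset.mul_sum, sum_parity]

/-- **The reference amplitude is `−alphaTor`.** -/
theorem refAmp_eq (hn : 9 ≤ n) {m ω₀ ω₁ : ℝ} (hM : 2 < m + 4 - Real.cos ω₀ - Real.cos ω₁) :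
    (if (0 : ZMod (2 * n)) = -1 then (-1 : ℂ) else 1) *
        ∑ i : Fin 4, ∑ j : Fin 4, (D1 n m ω₀ ω₁)⁻¹ (((0 : ZMod (2 * n)) + 1, (0 : ZMod (2 * n))), 0, i)
          (((0 : ZMod (2 * n)), (0 : ZMod (2 * n))), 0, j) * pMinus 2 j i = -alphaTor n m ω₀ ω₁ := by
  rw [if_neg (zero_ne_neg_one_zmod hn), one_mul, zero_add, alphaTor]
  have hc : ∀ c : Fin 3, ∑ i : Fin 4, ∑ j : Fin 4, (D1 n m ω₀ ω₁)⁻¹ ((1, 0), c, i) ((0, 0), c, j) * pMinus 2 j i =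
      ∑ i : Fin 4, ∑ j : Fin 4, (D1 n m ω₀ ω₁)⁻¹ ((1, 0), 0, i) ((0, 0), 0, j) * pMinus 2 j i := by
    intro c
    refine Finset.sum_congr rfl fun i _ => Finset.sum_congr rfl fun j _ => ?_
    rw [D1_eq_freeOp, free_inv_colour hM _ _ c c i j, if_pos rfl]
  simp only [hc, Finset.sum_const, Finset.card_univ, Fintype.card_fin, nsmul_eq_mul]
  push_cast
  ring

/-! ### The cell sub-stub -/

/-- **Part A**: `Re Tr X = −4 n² Re α · def(P)`. -/
theorem re_trace_X (hn : 9 ≤ n) (P : Matrix.unitaryGroup (Fin 3) ℂ) {m ω₀ ω₁ : ℝ}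
    (hM : 2 < m + 4 - Real.cos ω₀ - Real.cos ω₁) :
    ((X n P m ω₀ ω₁).trace).re = -4 * (n : ℝ) ^ 2 * (alphaTor n m ω₀ ω₁).re * defi P := by
  rw [trace_X_eq, fwd_sum_eq P hM, bwd_sum_eq P hM, colour_sum_star, colour_sum_eq, refAmp_eq hn hM, defi]
  simp only [Complex.mul_re, Complex.add_re, Complex.neg_re, Complex.mul_im, Complex.add_im, Complex.neg_im,
    Complex.star_def, Complex.conj_re, Complex.conj_im, map_mul, map_add, map_sub, map_natCast, Complex.sub_re,
    Complex.sub_im, Complex.natCast_re, Complex.natCast_im, Complex.conj_ofNat]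
  norm_num
  ring

/-- **Part B**: `|Re α − κ₁(M_ω, sin ω₀, sin ω₁, 14)| ≤ 10⁻⁶`. -/
theorem alphaTor_near_kappaOne (hn : 9 ≤ n) {m ω₀ ω₁ : ℝ} (hM : 589 / 100 ≤ m + 4 - Real.cos ω₀ - Real.cos ω₁) :
    |(alphaTor n m ω₀ ω₁).re - kappaOne (bigM m ω₀ ω₁) (Real.sin ω₀) (Real.sin ω₁) 14| ≤ 1 / 10 ^ 6 := by
  have hM2 : 2 < m + 4 - Real.cos ω₀ - Real.cos ω₁ := by linarith
  have hL : 17 ≤ 2 * n := two_mul_ge hn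
  have hnear := free_inv_block_near_planar (L₁ := 2 * n) (L₂ := 2 * n) hM hL hL
  set B : Matrix (Fin 4) (Fin 4) ℂ := Matrix.of fun i j : Fin 4 => (D1 n m ω₀ ω₁)⁻¹ (((1 : ZMod (2 * n)), (0 : ZMod (2 * n))), 0, i)
    (((0 : ZMod (2 * n)), (0 : ZMod (2 * n))), 0, j) with hB
  set Q : Matrix (Fin 4) (Fin 4) ℂ := propTrunc (m + 4 - Real.cos ω₀ - Real.cos ω₁) (Real.sin ω₀) (Real.sin ω₁) 14 (1, 0) with hQ
  have hA := refAmp_eq hn hM2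
  rw [if_neg (zero_ne_neg_one_zmod hn), one_mul, zero_add] at hA
  have hα : alphaTor n m ω₀ ω₁ = -(B * pMinus 2).trace := by
    rw [← neg_neg (alphaTor n m ω₀ ω₁), ← hA]
    simp only [Matrix.trace, Matrix.diag, Matrix.mul_apply, hB, Matrix.of_apply]
  have hκ : kappaOne (bigM m ω₀ ω₁) (Real.sin ω₀) (Real.sin ω₁) 14 = -((Q * pMinus 2).trace).re := rfl
  rw [hα, hκ, Complex.neg_re, neg_sub_neg, ← Complex.sub_re, ← Matrix.trace_sub, ← Matrix.sub_mul]
  have h := abs_re_trace_mul_pMinus_le (Q - B) 2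
  have hBQ : ‖Q - B‖ ≤ 1 / (4 * 10 ^ 6) := by
    rw [norm_sub_rev, hB, hQ, D1_eq_freeOp]
    exact hnear
  calc |((Q - B) * pMinus 2).trace.re| ≤ 4 * ‖Q - B‖ := h
    _ ≤ 4 * (1 / (4 * 10 ^ 6)) := by gcongr
    _ = 1 / 10 ^ 6 := by norm_num

end CellFO

open Cell CellKappa in
/-- **Cell sub-stub `cellFirstOrder`** (B6, line `Sketch`): for the checkerboard perturbation `X = D_1⁻¹(D_P − D_1)` of
the free 2D frequency operator on `(ℤ/2n)²`, the first-order term is EXACTLY `Re Tr X = −4 n² · Re α · def(P)`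
(colour triviality, `γ₅`-hermiticity and twisted translation covariance of the free propagator), and the torus link
amplitude `α` is within `10⁻⁶` of the certified planar one `kappaOne M_ω (sin ω₀) (sin ω₁) 14` (finite Neumann
expansion: walks of length `≤ 14` between the reference sites do not wrap for `n ≥ 9`, tail `‖K^15 G‖ ≤ (2/M)^15/(M−2)`). -/
theorem cellFirstOrder : ∀ (n : ℕ) [NeZero n], 9 ≤ n → ∀ (m : ℝ), |m| ≤ 1 / 10 → ∀ ω₀ ω₁ : ℝ, Real.cos ω₀ ≤ -(199 / 200) → Real.cos ω₁ ≤ -(199 / 200) → ∀ (P : Matrix.unitaryGroup (Fin 3) ℂ), ((X n P m ω₀ ω₁).trace).re = -4 * (n : ℝ) ^ 2 * (alphaTor n m ω₀ ω₁).re * defi P ∧ |(alphaTor n m ω₀ ω₁).re - kappaOne (bigM m ω₀ ω₁) (Real.sin ω₀) (Real.sin ω₁) 14| ≤ 1 / 10 ^ 6 :=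
  fun _ _ hn _ hm _ _ h0 h1 P =>
    ⟨CellFO.re_trace_X hn P (by linarith [CellFO.bigM_ge hm h0 h1]),
      CellFO.alphaTor_near_kappaOne hn (CellFO.bigM_ge hm h0 h1)⟩

end Summit.QuantumFields.QCD.Cruxes.CriticalLineDiamagnetism.ChessboardCellGain

end
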